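import Summits.CriticalPhenomena.Ising3DConformalLimit.Theses.PerfectScreening
import Summits.CriticalPhenomena.Ising3DConformalLimit.Theses.LeeYangGap
import Summits.CriticalPhenomena.Ising3DConformalLimit.Theorems.PerfectScreeningCoulombImpliesNontrivialOfUpperCriticalIsotherm
import Summits.CriticalPhenomena.Ising3DConformalLimit.Theorems.LeeYangGapMonotonicityTransfer
import Summits.CriticalPhenomena.Ising3DConformalLimit.Theorems.LeeYangGapFirstZeroAntitoneInBeta

/-!
# `CoulombImpliesNontrivial` (PerfectScreening r3) from `NearCriticalLeeYangGap` (LeeYangGap, stmt-4945)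

Crux `CoulombImpliesNontrivial` of route `PerfectScreening` (Ising3DConformalLimit), item
stmt-CriticalPhenomena-13885: `Coulomb lower bound c/‖x‖ ≤ ⟨σ₀σ_x⟩_{β_c} ⟹ every non-degenerate pointwise
scaling limit of criticalCorr 3 has U₄ ≢ 0`.

This file records, kernel-checked, that the crux is implied by an EXISTING open item of a neighbouring route:
the near-critical Lee–Yang gap `LeeYangGap.NearCriticalLeeYangGap` (stmt-CriticalPhenomena-4945: for infinitely
many `L`, some `β ∈ [0, β_c(3)]` and some zero `θ > 0` of `θ ↦ ⟨cos(θ M_L)⟩_β` have `θ²·⟨M_L²⟩_{β_c} ≤ C`).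
Chain (`stub_cruxOfNearCriticalLeeYangGap`, registered stub of line `SketchPub`, skeleton v9): under Coulomb
take a non-degenerate pointwise limit with `U₄ ≡ 0`; S4 `stub_blockVariance` + S7 `stub_gaussianKillsBinder`
(landed pieces of line `SketchPub`) give `g_L := (3Σ_L² − ⟨M_L⁴⟩)/Σ_L² → 0`; a zero at `β ≤ β_c` moves to a zero
`θ' ≤ θ` at `β_c` by the PROVED items `FirstZeroAntitoneInBeta` (4947, Camia–Jiang–Newman 2023 Thm 2, tree
theorem `firstZeroAntitoneInBeta_proof`) and `MonotonicityTransfer` (4948, `monotonicityTransfer_proof`);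
Newman's first-zero bound (package `sketchPub_blockPackage` = S1a + S1b, file `…OfUpperCriticalIsotherm.lean`) then gives `g_L ≥ 12/C²` along the
sequence — contradiction. So any proof of item 4945 closes r3 in one line. (Conversely, the line's own
residual R — the upper critical isotherm along a sequence, `stub_upperCriticalIsothermFrequently` — implies
`¬(g_L → 0)`, the `β = β_c` content of 4945; see the companion file on the isotherm reduction.)
-/


noncomputable section

namespace Summit.CriticalPhenomena.Ising3DConformalLimit.PerfectScreeningCoulombImpliesNontrivial

open Literature.Probability.LatticeModels Filter Set Finset
open scoped Topology BigOperators

/-- A Lee–Yang gap at the critical fluctuation scale ALONG A SEQUENCE forbids a vanishing block Binder cumulant: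
if for infinitely many `L` some `β ∈ [0, β_c(3)]` and some zero `θ > 0` of `⟨cos(θ M_L)⟩_β` satisfy
`θ²·Σ_L ≤ C` (`Σ_L = ⟨M_L²⟩_{β_c}`), then `g_L = (3Σ_L² − ⟨M_L⁴⟩)/Σ_L² ↛ 0`
(Camia–Jiang–Newman antitonicity 4947 + transfer 4948 move the zero to `β_c`; Newman's bound `12/θ'⁴ ≤ −u₄`). -/
theorem sketchPub_binderNonvanishing_of_nearCriticalLeeYangGap
    (hGAP : Summit.CriticalPhenomena.Ising3DConformalLimit.Theses.LeeYangGap.NearCriticalLeeYangGap) :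
    ¬ Tendsto (fun L : ℕ =>
        (3 * (plusExpect 3 (criticalBeta 3) 0 (fun σ => (∑ x ∈ box 3 L, spinAt x σ) ^ 2)) ^ 2 -
            plusExpect 3 (criticalBeta 3) 0 (fun σ => (∑ x ∈ box 3 L, spinAt x σ) ^ 4)) /
          (plusExpect 3 (criticalBeta 3) 0 (fun σ => (∑ x ∈ box 3 L, spinAt x σ) ^ 2)) ^ 2)
        atTop (𝓝 0) := by
  intro htend
  obtain ⟨C, hfreq⟩ := hGAP
  have hmono := Summit.CriticalPhenomena.Ising3DConformalLimit.Theorems.monotonicityTransfer_proof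
    Summit.CriticalPhenomena.Ising3DConformalLimit.Theorems.firstZeroAntitoneInBeta_proof
  -- at every `L` of the sequence: a zero `θ' ≤ θ` at `β_c`, hence `12/C² ≤ g_L` (and `0 < C`)
  have hstep : ∀ L : ℕ, (∃ β θ : ℝ, 0 ≤ β ∧ β ≤ criticalBeta 3 ∧ 0 < θ ∧
      θ ^ 2 * plusExpect 3 (criticalBeta 3) 0 (fun σ => (∑ x ∈ box 3 L, spinAt x σ) ^ 2) ≤ C ∧
      plusExpect 3 β 0 (fun σ => Real.cos (θ * ∑ x ∈ box 3 L, spinAt x σ)) = 0) →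
      0 < C ∧ 12 / C ^ 2 ≤
        (3 * (plusExpect 3 (criticalBeta 3) 0 (fun σ => (∑ x ∈ box 3 L, spinAt x σ) ^ 2)) ^ 2 -
            plusExpect 3 (criticalBeta 3) 0 (fun σ => (∑ x ∈ box 3 L, spinAt x σ) ^ 4)) /
          (plusExpect 3 (criticalBeta 3) 0 (fun σ => (∑ x ∈ box 3 L, spinAt x σ) ^ 2)) ^ 2 := by
    intro L ⟨β, θ, hβ, hβc, hθ, hθC, hzero⟩
    obtain ⟨θ', hθ', hθ'θ, hzero'⟩ := hmono L β (criticalBeta 3) θ hβ hβc le_rfl hθ hzero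
    have hVpos := sketchPub_blockVariance_pos L
    have hθ'C : θ' ^ 2 * plusExpect 3 (criticalBeta 3) 0 (fun σ => (∑ x ∈ box 3 L, spinAt x σ) ^ 2) ≤ C :=
      le_trans (mul_le_mul_of_nonneg_right (pow_le_pow_left₀ hθ'.le hθ'θ 2) hVpos.le) hθC
    obtain ⟨m, n, b, -, -, -, -, -, -, hN⟩ := sketchPub_blockPackage L
    refine ⟨lt_of_lt_of_le (mul_pos (pow_pos hθ' 2) hVpos) hθ'C, ?_⟩
    exact sketchPub_blockCoupling_ge hθ' hVpos hθ'C (hN θ' hθ' hzero')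
  -- `0 < C` from one member of the sequence
  obtain ⟨L₀, hL₀⟩ := hfreq.exists
  have hCpos : 0 < C := (hstep L₀ hL₀).1
  -- eventually `g_L < 12/C²`, frequently `g_L ≥ 12/C²`
  have hev := htend.eventually (gt_mem_nhds (show (0:ℝ) < 12 / C ^ 2 by positivity))
  obtain ⟨L, hL, hlt⟩ := (hfreq.and_eventually hev).exists
  exact absurd (hstep L hL).2 (not_le.2 hlt)

/-- **The crux r3 from the neighbouring crux `NearCriticalLeeYangGap` (stmt-CriticalPhenomena-4945)** — by name
(registered stub of line `SketchPub`, skeleton v9): under the Coulomb antecedent a non-degenerate pointwise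
limit with `U₄ ≡ 0` kills the block Binder cumulant (S4 `stub_blockVariance`, S7 `stub_gaussianKillsBinder`),
which the gap forbids (`sketchPub_binderNonvanishing_of_nearCriticalLeeYangGap`). -/
theorem stub_cruxOfNearCriticalLeeYangGap :
    Summit.CriticalPhenomena.Ising3DConformalLimit.Theses.LeeYangGap.NearCriticalLeeYangGap →
      Summit.CriticalPhenomena.Ising3DConformalLimit.Theses.PerfectScreening.CoulombImpliesNontrivial := by
  intro hGAP hC ρ S hρ hlim hnd
  by_contra hU4
  have hV := stub_blockVariance hC
  have htend := stub_gaussianKillsBinder hV ρ S hρ hlim hnd hU4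
  exact sketchPub_binderNonvanishing_of_nearCriticalLeeYangGap hGAP htend

end Summit.CriticalPhenomena.Ising3DConformalLimit.PerfectScreeningCoulombImpliesNontrivial

end
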